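import Summits.ABC.IUTFork.Joshi.TestGenuinePinsVacuityAllDegrees
import Summits.ABC.IUTFork.Joshi.TestGenuinePinsInhabitedDegreeOne
import HarnessLib

/-!
# Branch E TEST — the Y-26 CRITERION: genuine-carrier pins are INHABITED iff `F = ℚ` (R-J row Y-26, criterion object)

Proof-only packaging (abc-iut cell, D-0079 R-J «Joshi Y-discharge census», row Y-26; seat abc-iut-f-045, gen 7; 0 definitions, no
`Prop` fact, FACT rows used: none) of the two halves of row Y-26 into ONE biconditional in the style of the lane's criterion objects
(OBJECTS.tsv X-19…X-22): the EMPTY side is this seat's `Joshi/TestGenuinePinsVacuityAllDegrees.lean` (p503388,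
`finrank_eq_one_of_pinnedRegions_settingPrVolSharp`: pins ⇒ `[F:ℚ] = 1`, E-ROW R-55), the INHABITED side is abc-iut-E-t41's
`Joshi/TestGenuinePinsInhabitedDegreeOne.lean` (p463284, `GenuinePinsDegOne.exists_pinnedRegions_settingPrVolSharp_of_finrank_eq_one`:
`[F:ℚ] = 1` ⇒ `∃ ρ qK`, pins, for non-zero Θ-ideles `t`).

* **`exists_pinnedRegions_settingPrVolSharp_iff_finrank_eq_one`** — for every number field `F`, pilot datum `X`, column and context
  binders and NON-ZERO ideles `t`, `tq` at abc-iut-c312-7's `settingPrVolSharp` over `LatticeSituation.ofShells (logShellsDH X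
  (analyticLogv F)) …`: **`(∃ ρ qK, PinnedRegions … ρ qK) ↔ [F:ℚ] = 1`**; the `PinnedRegions3` form
  `exists_pinnedRegions3_settingPrVolSharp_iff_finrank_eq_one` (inhabited side via E-t41's `exists_pinnedRegions3_…_of_localDeg_eq_one`
  is not needed: `PinnedRegions3 → PinnedRegions` gives `⇒`, and `⇐` is stated for `PinnedRegions` only — so the `3`-form is the
  one-directional `exists_pinnedRegions3_settingPrVolSharp_imp_finrank_eq_one`).

HONEST SCOPE: OUR interface's pins at OUR sharp real container under Dupuy–Hilado's typed (Ind1)/(Ind2); genuine initial Θ-data never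
have `F = ℚ` ([IUTchI] Def. 3.1), so the inhabited side is a CONSISTENCY datum about the typed pins, not a case of [IUTchIII] Cor. 3.12;
print's (xi-e)/(xi-f) untouched; locates / conditionally verifies; typed ≠ proved; no side taken on any author; no abc claim.
[claim: Mochizuki2012, status: disputed] [cite: DupuyHilado2025, §3.9, §4.7, §4.9]
-/

noncomputable section

open Set Function NumberField IsDedekindDomain Metric
open scoped Pointwise Classical

namespace Summit.ABC.IUTFork.Joshi

open Thm311 Thm311.Real Cor312 Cor312Vol Literature.IUT.LogThetaLattice Literature.IUT.LogVolume
  Literature.IUT.HodgeTheaters Literature.NumberTheory.NumberFields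
open Literature.NumberTheory.GaloisRepresentations.Ultrametric
open GenuinePinsResidual GenuinePinsDividingLine

variable {F : Type} [Field F] [NumberField F] (X : PilotData F)
  (M : Type) [Field M] [NumberField M]
  (archPk : ∀ (j : (thetaIndex X).Label) (vQ : (thetaIndex X).VQ), Set ((logShellsDH X (analyticLogv F)).Packet j vQ))
  (archSub : ∀ (j : (thetaIndex X).Label) (v : (thetaIndex X).V),
    Set ((logShellsDH X (analyticLogv F)).Packet j ((thetaIndex X).over v)))
  (Ψ : ℤ → ∀ v : (thetaIndex X).V, v ∈ (thetaIndex X).Vbad → Set ((logShellsDH X (analyticLogv F)).StarPacket v))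
  (act : ℤ → ∀ v : (thetaIndex X).V, v ∈ (thetaIndex X).Vbad →
    (logShellsDH X (analyticLogv F)).StarPacket v → Module.End ℚ ((logShellsDH X (analyticLogv F)).StarPacket v))
  (Mmod : ℤ → ∀ j : (thetaIndex X).LabelStar, Set ((logShellsDH X (analyticLogv F)).GlobalPacket j.1))
  (region : ℤ → ∀ j : (thetaIndex X).LabelStar, FinDivisor M → ∀ vQ : (thetaIndex X).VQ,
    Set ((logShellsDH X (analyticLogv F)).Packet j.1 vQ))
  (frobAdm : ℤ → ℤ → ∀ (j : (thetaIndex X).Label) (vQ : (thetaIndex X).VQ),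
    Set ((logShellsDH X (analyticLogv F)).Packet j vQ) → Prop)
  (frobLogvol : ℤ → ℤ → ∀ (j : (thetaIndex X).Label) (vQ : (thetaIndex X).VQ),
    Set ((logShellsDH X (analyticLogv F)).Packet j vQ) → ℝ)
  (frobΨ : ℤ → ℤ → ∀ v : (thetaIndex X).V, v ∈ (thetaIndex X).Vbad → Set ((logShellsDH X (analyticLogv F)).StarPacket v))
  (frobMmod : ℤ → ℤ → ∀ j : (thetaIndex X).LabelStar, Set ((logShellsDH X (analyticLogv F)).GlobalPacket j.1))
  (unitImage : ℤ → ℤ → ℕ → ∀ (j : (thetaIndex X).Label) (vQ : (thetaIndex X).VQ),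
    Set ((logShellsDH X (analyticLogv F)).Packet j vQ))
  (ballImage : ℤ → ℤ → ∀ (j : (thetaIndex X).Label) (vQ : (thetaIndex X).VQ),
    Set ((logShellsDH X (analyticLogv F)).Packet j vQ))
  (thetaDiv : ℤ → ℤ → LgpDivisor M (thetaIndex X).lstar)
  (n : ℤ) {HT : Type} {LogLink : HT → HT → Type} {IsFull : ∀ {s t : HT}, LogLink s t → Prop}
  (lat : LGPGaussianLogThetaLattice LogLink IsFull)
  {Frd : Type} {IsoF : Frd → Frd → Type} {Ob : Frd → Type} {realify : Frd → Frd} {Strip : Type}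
  {IsoS : Strip → Strip → Type} {Mv : ∀ v : (thetaIndex X).V, v ∈ (thetaIndex X).Vbad → Type}
  [∀ v h, Monoid (Mv v h)]
  (sig : GlobalLGPFrobenioidSignature (thetaIndex X).lstar (thetaIndex X).V (· ∈ (thetaIndex X).Vbad)
    Frd IsoF Ob realify Strip IsoS Mv)
  (split : SplittingMonoids Mv) {ObΔ : Type} {N : ∀ v : (thetaIndex X).V, v ∈ (thetaIndex X).Vbad → Type}
  [∀ v h, Monoid (N v h)] (qData : QPilotData ObΔ N)
  (t : ∀ (pp : Nat.Primes) (_ : Fin X.lstar) (x : (thetaIndex X).Fibre (.inr pp)),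
    haveI : Fact (pp : ℕ).Prime := ⟨pp.2⟩; kOf X pp.1 x)
  (tq : ∀ (pp : Nat.Primes) (x : (thetaIndex X).Fibre (.inr pp)), haveI : Fact (pp : ℕ).Prime := ⟨pp.2⟩; kOf X pp.1 x)
  (ρ : (∀ v : (thetaIndex X).V, v ∈ (thetaIndex X).Vbad → Set ((logShellsDH X (analyticLogv F)).StarPacket v)) →
    ∀ (j : (thetaIndex X).Label) (vQ : (thetaIndex X).VQ), Set ((logShellsDH X (analyticLogv F)).Packet j vQ))
  (qK : ∀ v : (thetaIndex X).V, v ∈ (thetaIndex X).Vbad → Set ((logShellsDH X (analyticLogv F)).StarPacket v))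
  (htq0 : ∀ pp x, tq pp x ≠ 0)
  (htq1 : ∀ (pp : Nat.Primes) (x : (thetaIndex X).Fibre (.inr pp)),
    haveI : Fact (pp : ℕ).Prime := ⟨pp.2⟩; placeOf X pp.1 x ∉ X.S → ‖tq pp x‖ = 1)
  (ht0 : ∀ pp i x, t pp i x ≠ 0)

include ht0 in
/-- **THE Y-26 CRITERION: `(∃ ρ qK, PinnedRegions at settingPrVolSharp) ↔ [F:ℚ] = 1`** for non-zero Θ-ideles — EMPTY side = R-55
(`finrank_eq_one_of_pinnedRegions_settingPrVolSharp`, p503388), INHABITED side = abc-iut-E-t41's p463284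
(`GenuinePinsDegOne.exists_pinnedRegions_settingPrVolSharp_of_finrank_eq_one`). [cite: DupuyHilado2025, §4.9]
[claim: Mochizuki2012, status: disputed] -/
theorem exists_pinnedRegions_settingPrVolSharp_iff_finrank_eq_one :
    (∃ (ρ : (∀ v : (thetaIndex X).V, v ∈ (thetaIndex X).Vbad → Set ((logShellsDH X (analyticLogv F)).StarPacket v)) →
          ∀ (j : (thetaIndex X).Label) (vQ : (thetaIndex X).VQ), Set ((logShellsDH X (analyticLogv F)).Packet j vQ))
      (qK : ∀ v : (thetaIndex X).V, v ∈ (thetaIndex X).Vbad → Set ((logShellsDH X (analyticLogv F)).StarPacket v)),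
      Cor312Vol.PinnedRegions
        (LatticeSituation.ofShells (logShellsDH X (analyticLogv F)) M archPk archSub
          (summandPiecesPr X (logvAnalytic_analyticLogv (F := F))).Adm
          (summandPiecesPr X (logvAnalytic_analyticLogv (F := F))).logvol Ψ act Mmod region frobAdm frobLogvol frobΨ frobMmod
          unitImage ballImage thetaDiv)
        (settingPrVolSharp X (logvAnalytic_analyticLogv (F := F)) M archPk archSub Ψ act Mmod region n lat sig split qData tq t
          htq0 htq1) ρ qK) ↔
      Module.finrank ℚ F = 1 :=
  ⟨fun ⟨ρ, qK, h⟩ => finrank_eq_one_of_pinnedRegions_settingPrVolSharp X M archPk archSub Ψ act Mmod region frobAdm frobLogvol frobΨ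
      frobMmod unitImage ballImage thetaDiv n lat sig split qData t tq ρ qK htq0 htq1 h,
    fun hF => GenuinePinsDegOne.exists_pinnedRegions_settingPrVolSharp_of_finrank_eq_one X M archPk archSub Ψ act Mmod region frobAdm frobLogvol frobΨ
      frobMmod unitImage ballImage thetaDiv n lat sig split qData t tq ht0 htq0 htq1 hF⟩

/-- The `PinnedRegions3` reading: `(∃ ρ qK, PinnedRegions3 …) → [F:ℚ] = 1`. [claim: Mochizuki2012, status: disputed] -/
theorem exists_pinnedRegions3_settingPrVolSharp_imp_finrank_eq_one
    (h : ∃ (ρ : (∀ v : (thetaIndex X).V, v ∈ (thetaIndex X).Vbad → Set ((logShellsDH X (analyticLogv F)).StarPacket v)) →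
          ∀ (j : (thetaIndex X).Label) (vQ : (thetaIndex X).VQ), Set ((logShellsDH X (analyticLogv F)).Packet j vQ))
      (qK : ∀ v : (thetaIndex X).V, v ∈ (thetaIndex X).Vbad → Set ((logShellsDH X (analyticLogv F)).StarPacket v)),
      Cor312Vol.PinnedRegions3
        (LatticeSituation.ofShells (logShellsDH X (analyticLogv F)) M archPk archSub
          (summandPiecesPr X (logvAnalytic_analyticLogv (F := F))).Adm
          (summandPiecesPr X (logvAnalytic_analyticLogv (F := F))).logvol Ψ act Mmod region frobAdm frobLogvol frobΨ frobMmod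
          unitImage ballImage thetaDiv)
        (settingPrVolSharp X (logvAnalytic_analyticLogv (F := F)) M archPk archSub Ψ act Mmod region n lat sig split qData tq t
          htq0 htq1) ρ qK) :
    Module.finrank ℚ F = 1 := by
  obtain ⟨ρ, qK, h3⟩ := h
  exact finrank_eq_one_of_pinnedRegions3_settingPrVolSharp X M archPk archSub Ψ act Mmod region frobAdm frobLogvol frobΨ
      frobMmod unitImage ballImage thetaDiv n lat sig split qData t tq ρ qK htq0 htq1 h3

end Summit.ABC.IUTFork.Joshi
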